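import Summits.QuantumFields.BalabanUV.Beta.GAN24.SlavedSummandLetterRows
import Summits.QuantumFields.BalabanUV.Beta.GAN24.WrecAtSlotRowsFinal
import Summits.QuantumFields.BalabanUV.Beta.AveragingWardRootedStencils

/-!
# `BalabanUV.Beta.GAN24.BlockCommutatorStepLetter` — binder row G-an2-4 ∕ (CONV-C), W-slot EXIT (α) (RULING R-lead-g77-1 (2); the (α-0) parity re-cut, piece (α-END-b) —
# the even member's cell row `hcell`, SLOT half): **THE S-STEP LETTER ROWS `hE₁ ∕ hE₂` OF leaf-01 g72's `HalfMemberSlavedDivergenceLetters` AT `ε = 1`, UNIFORMLY IN THE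
# LEVEL, FROM leaf-03 g66's `SlavedSummandLetterRows` letters, the block's leg-indicator symbol and ONE scalar row; the `d = 3` discharge modulo that scalar row**
# (road-P2 chair of row G-an2-4, unit `b2b-balaban-gan24-p2` gen 45, crux team (2); v2 = a wrapper over leaf-03's letters — lines crossed with their gen 66, disclosed
# in the cell journal; v2.1 = THIS module docstring only (v2 carried a placeholder — leaf-03 g66's X2 DOCFIX D-X2-1), every declaration byte-identical to v2)

NOT IN PRINT; OUR BOOKKEEPING ([folklore] kernel algebra + composition BY NAME; 0 `def`, 0 cited facts, 0 `def … : Prop`, 0 sorry).  HONEST FRAMING (cell contract,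
verbatim): «discharging `BetaPertH` makes Bałaban's UV stability UNCONDITIONAL — a real constructive-QFT result; it is NOT the continuum limit and NOT the Clay problem.»
HONEST DEPENDENCY (verbatim): «continuum YM on T⁴ ⇐ BetaPertH ∧ nine spine estimates (0/9 proved); BetaPertH ⇐ (D1) ∧ (D4) ∧ CAP+tail; G-an2-4 gates asym, D1 and
NE2/3/4.»

WHAT (objects: the dressed one-step resolvents `K♮ᴱ_l = unitK_l (coDressKBmAt ρ Lc (KInvStep Lc l))`, the unfolded first-order tables `S_l = SpureRecAt d Lc ρ cE cVH cΛ l`,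
the block generators `X p = diagK (½ • Σ_{v ∈ box} legInd ρ (Lc • p + v))`, in-block root `ρ = toSite r`, unit scalars `sfStep ∕ smStep` (road P1's `CombesThomas`)):
* §1 (generic `d`) `l1_toSite_le_of_mem_box` (a box point has `|toSite v|₁ ≤ (d+1)·Lc`), `abs_blockLegInd_le` (the block's leg-indicator symbol is bounded by `½·#box` —
  the `cg` of leaf-03's `evenRows_of_Srow`), `blockLegInd_support` (it is supported on the block's legs, width `2·((d+1)·Lc)` — the `W` of `evenRows_of_Srow`).
* §2 (generic `d`, `1 ≤ Lc`) **`exists_evenRows_uniform_of_rows`** — A SOCKET: leaf-03 g66's `SlavedSummandLetterRows.evenRows_of_Srow` level by level with §1 for the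
  block symbol, the constant factored through the scalar `|(sf_l·sm_l)⁻¹·(cH l)⁻¹| ≤ c₀` (DISPLAYED row `hcH`; at the comb pin that product is `l`-free — d1-leaf-07's
  `c_H` —, whereas a constant lock scalar would be WRONG: D1's `hlock` makes `cH l` level-dependent): from the dressed-K uniform row `hG`, «S′Shape» `hS` and `hcH`,
  `∃ CE δE, 0 < δE ∧ ∀ l, hE₁(l) ∧ hE₂(l)` with ONE `(CE, δE)` — leaf-01 g72's (b1) PART 4 binders `hE₁ ∕ hE₂` at `ε = 1`, for ANY residual letters `R l`, `R″ l`
  (they enter with the factor `(1 − 1)/2 = 0`).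
* §3 (`d = 3`, `2 ≤ Lc`, pin `cE = Lc^{3+1}`) **`exists_evenRows_uniform_three`** — §2 with `hG` := road P1's `KSlotAssembly.convCKWall_holds` ⨾ asym1's
  `HessKerCoDressedBmWall.exists_coDressedBm_unit_rows` and `hS` := the OWNER gan24-p1 g22's `SrecAtSlotRowsFinal.exists_hS_hSall_SrecAt_three` ⨾ MY
  `WrecAtSlotRows.exists_spureRecAt_rows_three_of_srecAt_rows`: the rows for ALL levels MODULO `hcH` ONLY.
READING: the located row (ii) of leaf-01 g72's recipe for the whole tower — the S-slot input of the (α-END-b) `hcell` chain is discharged down to road P1's K-slot and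
the OWNER's S-slot END; the LEG half of `hcell` is (Q-L) (OPEN, display (H1)^{⊥}).  CONDITIONAL on the displayed rows; asserts NO bound on Bałaban's tables beyond them;
discharges NOTHING of `hcell` ∕ (Q-L) ∕ (C) ∕ «T2Shape^{ev}» ∕ (hW, hWall); NEVER «G-an2-4 closed» as (CONV-C); NOT D1, NOT `BetaPertH`, NOT continuum, NOT Clay; not in
print — our bookkeeping.  2026-08-23.
-/

noncomputable section

open Finset
open scoped BigOperators
open Literature.MathematicalPhysics.QuantumFieldTheory
open Literature.MathematicalPhysics.QuantumFieldTheory.Balaban1983to89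
open Literature.MathematicalPhysics.QuantumFieldTheory.Balaban1983to89.Beta
open B12Sec2to5 (l1 l1_nonneg)
open ExpKernelCalculus (MKer Decays BiLoc Zl comp l1_sub_triangle Zl_nonneg)
open OneStepResolventKernel (Fib LocStencil decays_mono)
open OneStepKernelFamily (KInvStep)
open AffineAveraging (box toSite)
open BalabanCompositeJets (LocStencil₂)
open Summit.QuantumFields.BalabanUV.Beta.BorderedHessian (diagK)
open Summit.QuantumFields.BalabanUV.Beta.AveragingWardRootedStencils (legInd legSite legInd_apply legSite_inl legSite_inr)
open Summit.QuantumFields.BalabanUV.Beta.HessKerDressedUnits (unitK unitS)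
open Summit.QuantumFields.BalabanUV.Beta.AxialDressingRooted (coDressKBmAt)
open Summit.QuantumFields.BalabanUV.Beta.SpineRooted (SpureRecAt e3OfK)
open Summit.QuantumFields.BalabanUV.Beta.WardLocusRecursive (SrecAt)
open Summit.QuantumFields.BalabanUV.Beta.HessKerCoDressedBmWall (exists_coDressedBm_unit_rows)
open Summit.QuantumFields.BalabanUV.Beta.GAN24.CombesThomas (sfStep smStep sfStep_ne_zero smStep_ne_zero)
open Summit.QuantumFields.BalabanUV.Beta.GAN24.KSlotAssembly (convCKWall_holds)
open Summit.QuantumFields.BalabanUV.Beta.GAN24.StencilSlotOfShapes (locStencil_mono')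
open Summit.QuantumFields.BalabanUV.Beta.GAN24.WSlotCauchyOfShapes (locStencil₂_le_mono)
open Summit.QuantumFields.BalabanUV.Beta.GAN24.WrecAtSlotRows (exists_spureRecAt_rows_three_of_srecAt_rows)
open Summit.QuantumFields.BalabanUV.Beta.GAN24.SrecAtSlotRowsFinal (exists_hS_hSall_SrecAt_three)
open Summit.QuantumFields.BalabanUV.Beta.GAN24.SlavedSummandLetterRows (evenRows_of_Srow)

namespace Summit.QuantumFields.BalabanUV.Beta.GAN24.BlockCommutatorStepLetter

variable {d : ℕ} {Lc : ℕ} [NeZero Lc] {r : Fin (d + 1) → ℕ}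

/-! ## §1 The block's diagonal generator: its leg-indicator symbol is bounded and supported on the block's legs -/

omit [NeZero Lc] in
/-- [folklore] A box point has `|toSite v|₁ ≤ (d+1)·Lc`. -/
theorem l1_toSite_le_of_mem_box {v : Fin (d + 1) → ℕ} (hv : v ∈ box (d + 1) Lc) : l1 (toSite v) ≤ ((d + 1 : ℕ) : ℝ) * Lc := by
  have hvi : ∀ i, (v i : ℝ) ≤ Lc := by
    intro i
    have h := Fintype.mem_piFinset.mp hv i
    rw [Finset.mem_range] at h
    exact_mod_cast h.le
  unfold B12Sec2to5.l1 AffineAveraging.toSite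
  calc ∑ μ, |(((v μ : ℕ) : ℤ) : ℝ)| = ∑ μ, (v μ : ℝ) := Finset.sum_congr rfl fun μ _ => by
          rw [Int.cast_natCast, abs_of_nonneg (Nat.cast_nonneg _)]
    _ ≤ ∑ _μ : Fin (d + 1), (Lc : ℝ) := Finset.sum_le_sum fun μ _ => hvi μ
    _ = ((d + 1 : ℕ) : ℝ) * Lc := by rw [Finset.sum_const, Finset.card_univ, Fintype.card_fin, nsmul_eq_mul]

omit [NeZero Lc] in
/-- [folklore] **THE BLOCK's LEG-INDICATOR SYMBOL IS BOUNDED**: `|(½ • Σ_{v∈box} legInd ρ (Lc•p + v)) z b| ≤ ½·#box` (the `cg` of leaf-03 g66's `evenRows_of_Srow`). -/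
theorem abs_blockLegInd_le (ρ p z : Fin (d + 1) → ℤ) (b : Fib d) :
    |(((1 : ℝ) / 2) • ∑ v ∈ box (d + 1) Lc, legInd ρ ((Lc : ℤ) • p + toSite v)) z b| ≤ (1 : ℝ) / 2 * (box (d + 1) Lc).card := by
  rw [Pi.smul_apply, Pi.smul_apply, Finset.sum_apply, Finset.sum_apply, smul_eq_mul, abs_mul, abs_of_pos (by norm_num : (0 : ℝ) < 1 / 2)]
  refine mul_le_mul_of_nonneg_left ((Finset.abs_sum_le_sum_abs _ _).trans ?_) (by norm_num)
  have h : ∀ v ∈ box (d + 1) Lc, |legInd ρ ((Lc : ℤ) • p + toSite v) z b| ≤ 1 := by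
    intro v _
    rw [legInd_apply]
    split_ifs <;> simp
  refine (Finset.sum_le_sum h).trans ?_
  rw [Finset.sum_const, nsmul_eq_mul, mul_one]

omit [NeZero Lc] in
/-- [folklore] **THE BLOCK's LEG-INDICATOR SYMBOL IS SUPPORTED ON THE BLOCK's LEGS** (the `W` of `evenRows_of_Srow`): for an in-block root `ρ = toSite r`,
`(½ • Σ_{v∈box} legInd ρ (Lc•p + v)) z b ≠ 0 → |z − Lc•p|₁ ≤ 2·((d+1)·Lc)` (`legSite ρ z b ∈ {z, z + ρ}`). -/
theorem blockLegInd_support (hr : r ∈ box (d + 1) Lc) (p z : Fin (d + 1) → ℤ) (b : Fib d)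
    (h : (((1 : ℝ) / 2) • ∑ v ∈ box (d + 1) Lc, legInd (toSite r) ((Lc : ℤ) • p + toSite v)) z b ≠ 0) :
    l1 (z - (Lc : ℤ) • p) ≤ 2 * (((d + 1 : ℕ) : ℝ) * Lc) := by
  rw [Pi.smul_apply, Pi.smul_apply, Finset.sum_apply, Finset.sum_apply, smul_eq_mul] at h
  have h' : ∑ v ∈ box (d + 1) Lc, legInd (toSite r) ((Lc : ℤ) • p + toSite v) z b ≠ 0 := by
    intro h0; exact h (by rw [h0, mul_zero])
  obtain ⟨v, hv, hne⟩ := Finset.exists_ne_zero_of_sum_ne_zero h'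
  rw [legInd_apply] at hne
  have hsite : legSite (toSite r) z b = (Lc : ℤ) • p + toSite v := by
    by_contra hc; exact hne (if_neg hc)
  have hvb := l1_toSite_le_of_mem_box hv
  have hrb := l1_toSite_le_of_mem_box hr
  rcases b with α | μ
  · rw [legSite_inl] at hsite
    have e : z - (Lc : ℤ) • p = toSite v := by rw [hsite]; abel
    rw [e]
    nlinarith [l1_nonneg (toSite r : Fin (d + 1) → ℤ)]
  · rw [legSite_inr] at hsite
    have e : z - (Lc : ℤ) • p = toSite v - toSite r := by
      have : z = (Lc : ℤ) • p + toSite v - toSite r := by rw [← hsite]; abel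
      rw [this]; abel
    rw [e]
    have t : l1 (toSite v - toSite r : Fin (d + 1) → ℤ) ≤ l1 (toSite v - 0 : Fin (d + 1) → ℤ) + l1 ((0 : Fin (d + 1) → ℤ) - toSite r) :=
      l1_sub_triangle _ _ _
    rw [sub_zero, zero_sub, OneStepKernelFamily.l1_neg_eq] at t
    linarith

/-! ## §2 Generic `d`: the rows `hE₁ ∕ hE₂` of (b1) PART 4 at `ε = 1` for the literal's dressed resolvents and first-order tables, ONE `(CE, δE)` FOR ALL LEVELS -/

/-- NOT IN PRINT; OUR BOOKKEEPING — A SOCKET ([folklore] composition: leaf-03 g66's `SlavedSummandLetterRows.evenRows_of_Srow` level by level at the literal, §1 for the block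
symbol, and the monotonicity of its constant in the scalar `|(sf_l·sm_l)⁻¹·(cH l)⁻¹|`; generic `d`, in-block root `r`, `1 ≤ Lc`).  **THE S-STEP LETTER ROWS `hE₁ ∕ hE₂` OF
leaf-01 g72's `HalfMemberSlavedDivergenceLetters.slotLetters_halfMember_succ_of_rows` AT `ε = 1`, FOR THE DRESSED ONE-STEP RESOLVENTS `K♮ᴱ_l = unitK_l (coDressKBmAt ρ Lc (KInvStep Lc
l))`, THE UNFOLDED FIRST-ORDER TABLES `S_l = SpureRecAt d Lc ρ cE cVH cΛ l`, THE BLOCK GENERATORS `X p = diagK (½ • Σ_{v∈box} legInd ρ (Lc•p + v))`, ANY residual letters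
`R l`, `R″ l`, ANY lock constants `cH l` — UNIFORMLY IN THE LEVEL**: from the dressed-K uniform row `hG`, «S′Shape» `hS` and ONE scalar row `hcH : ∀ l, |(sf_l·sm_l)⁻¹·(cH l)⁻¹| ≤ c₀`
(at the comb pin the product is `l`-free — d1-leaf-07's `c_H`), `∃ CE δE, 0 < δE ∧ ∀ l, hE₁(l) ∧ hE₂(l)` with ONE `(CE, δE)`.  The two K∕S rows are LETTERS here (TREE at `d = 3`: §3).
Asserts NO bound beyond the displayed rows; NOTHING of `hcell` ∕ (Q-L) ∕ (C) ∕ «T2Shape^{ev}» discharged. -/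
theorem exists_evenRows_uniform_of_rows (hLc : 1 ≤ Lc) (hr : r ∈ box (d + 1) Lc) (cE cVH cΛ cout : ℝ) (cH : ℕ → ℝ) {c₀ : ℝ}
    (hcH : ∀ l, |(sfStep Lc l * smStep d Lc l)⁻¹ * (cH l)⁻¹| ≤ c₀) {C δ : ℝ}
    (hG : ∀ j, Decays (unitK (sfStep Lc j) (smStep d Lc j) (coDressKBmAt (toSite r) Lc (KInvStep (d := d) Lc j))) C δ) (hδ : 0 < δ)
    {Cs δs : ℝ} (hS : ∀ j, LocStencil (unitS (sfStep Lc j) (smStep d Lc j) (SpureRecAt d Lc (toSite r) cE cVH cΛ j)) Cs δs) (hδs : 0 < δs)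
    (R R'' : ℕ → (Fin (d + 1) → ℤ) → Fin (d + 1) → (Fin (d + 1) → ℤ) → MKer (d + 1) (Fib d)) :
    ∃ CE δE : ℝ, 0 < δE ∧ ∀ l,
      LocStencil₂ (fun (_ : Fin (d + 1)) (p : Fin (d + 1) → ℤ) (κ' : Fin (d + 1)) (u' : Fin (d + 1) → ℤ) =>
          cout • (e3OfK Lc (unitK (sfStep Lc l) (smStep d Lc l) (coDressKBmAt (toSite r) Lc (KInvStep (d := d) Lc l)))
              (fun κ' u' => (sfStep Lc l * smStep d Lc l)⁻¹ • unitS (sfStep Lc l) (smStep d Lc l)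
                (fun κ' u' => (cH l)⁻¹ • ((((1 : ℝ) + 1) / 2) • (comp (SpureRecAt d Lc (toSite r) cE cVH cΛ l κ' u')
                    (diagK (((1 : ℝ) / 2) • ∑ v ∈ box (d + 1) Lc, legInd (toSite r) ((Lc : ℤ) • p + toSite v)))
                  - comp (diagK (((1 : ℝ) / 2) • ∑ v ∈ box (d + 1) Lc, legInd (toSite r) ((Lc : ℤ) • p + toSite v)))
                    (SpureRecAt d Lc (toSite r) cE cVH cΛ l κ' u')) + (((1 : ℝ) - 1) / 2) • R l p κ' u')) κ' u') κ' u'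
            + e3OfK Lc (unitK (sfStep Lc l) (smStep d Lc l) (coDressKBmAt (toSite r) Lc (KInvStep (d := d) Lc l)))
              (fun κ u => (sfStep Lc l * smStep d Lc l)⁻¹ • unitS (sfStep Lc l) (smStep d Lc l)
                (fun κ u => (cH l)⁻¹ • ((((1 : ℝ) + 1) / 2) • (comp (SpureRecAt d Lc (toSite r) cE cVH cΛ l κ u)
                    (diagK (((1 : ℝ) / 2) • ∑ v ∈ box (d + 1) Lc, legInd (toSite r) ((Lc : ℤ) • p + toSite v)))
                  - comp (diagK (((1 : ℝ) / 2) • ∑ v ∈ box (d + 1) Lc, legInd (toSite r) ((Lc : ℤ) • p + toSite v)))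
                    (SpureRecAt d Lc (toSite r) cE cVH cΛ l κ u)) + (((1 : ℝ) - 1) / 2) • R'' l p κ u)) κ u) κ' u')) CE δE ∧
      LocStencil₂ (fun (κ : Fin (d + 1)) (u : Fin (d + 1) → ℤ) (_ : Fin (d + 1)) (p : Fin (d + 1) → ℤ) =>
          cout • (e3OfK Lc (unitK (sfStep Lc l) (smStep d Lc l) (coDressKBmAt (toSite r) Lc (KInvStep (d := d) Lc l)))
              (fun κ' u' => (sfStep Lc l * smStep d Lc l)⁻¹ • unitS (sfStep Lc l) (smStep d Lc l)
                (fun κ' u' => (cH l)⁻¹ • ((((1 : ℝ) + 1) / 2) • (comp (SpureRecAt d Lc (toSite r) cE cVH cΛ l κ' u')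
                    (diagK (((1 : ℝ) / 2) • ∑ v ∈ box (d + 1) Lc, legInd (toSite r) ((Lc : ℤ) • p + toSite v)))
                  - comp (diagK (((1 : ℝ) / 2) • ∑ v ∈ box (d + 1) Lc, legInd (toSite r) ((Lc : ℤ) • p + toSite v)))
                    (SpureRecAt d Lc (toSite r) cE cVH cΛ l κ' u')) + (((1 : ℝ) - 1) / 2) • R l p κ' u')) κ' u') κ u
            + e3OfK Lc (unitK (sfStep Lc l) (smStep d Lc l) (coDressKBmAt (toSite r) Lc (KInvStep (d := d) Lc l)))
              (fun κ u => (sfStep Lc l * smStep d Lc l)⁻¹ • unitS (sfStep Lc l) (smStep d Lc l)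
                (fun κ u => (cH l)⁻¹ • ((((1 : ℝ) + 1) / 2) • (comp (SpureRecAt d Lc (toSite r) cE cVH cΛ l κ u)
                    (diagK (((1 : ℝ) / 2) • ∑ v ∈ box (d + 1) Lc, legInd (toSite r) ((Lc : ℤ) • p + toSite v)))
                  - comp (diagK (((1 : ℝ) / 2) • ∑ v ∈ box (d + 1) Lc, legInd (toSite r) ((Lc : ℤ) • p + toSite v)))
                    (SpureRecAt d Lc (toSite r) cE cVH cΛ l κ u)) + (((1 : ℝ) - 1) / 2) • R'' l p κ u)) κ u) κ u)) CE δE := by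
  have hC : 0 ≤ C := (hG 0).nonneg (Sum.inl 0)
  have hCs : 0 ≤ Cs := ((hS 0) 0 0).nonneg (Sum.inl 0)
  have hc₀ : 0 ≤ c₀ := (abs_nonneg _).trans (hcH 0)
  have hm : 0 < min δs δ / 2 := by positivity
  have hZ0 : 0 ≤ Zl (d + 1) (min δs δ / 2) := Zl_nonneg hm
  have hZ1 : 0 ≤ Zl (d + 1) (min δs δ / 2 / 2 - min δs δ / 2 / 4) := Zl_nonneg (by linarith)
  have hZ2 : 0 ≤ Zl (d + 1) (min δs δ / 2 / 4 - min δs δ / 2 / 8) := Zl_nonneg (by linarith)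
  -- the constant of `evenRows_of_Srow` as a function of the scalar `q = |(sf·sm)⁻¹·cH⁻¹|`
  set M : ℝ := (Fintype.card (Fib d) : ℝ) * ((Fintype.card (Fib d) : ℝ) * (C * (2 * ((1 : ℝ) / 2 * (box (d + 1) Lc).card) *
      (((d + 1 : ℕ) : ℝ) * (C * Cs * Zl (d + 1) (min δs δ / 2))) * Real.exp (min δs δ / 2 / 2 * (2 * (((d + 1 : ℕ) : ℝ) * Lc))))) *
      Zl (d + 1) (min δs δ / 2 / 2 - min δs δ / 2 / 4) * C) * Zl (d + 1) (min δs δ / 2 / 4 - min δs δ / 2 / 8) with hM_def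
  have hM : 0 ≤ M := by positivity
  refine ⟨|cout| * (c₀ * M + c₀ * M), min δs δ / 2 / 8, by positivity, fun l => ?_⟩
  have h := evenRows_of_Srow (N := Lc) (R := R l) (R'' := R'' l)
    (X := fun p => diagK (((1 : ℝ) / 2) • ∑ v ∈ box (d + 1) Lc, legInd (toSite r) ((Lc : ℤ) • p + toSite v)))
    (g := fun p => ((1 : ℝ) / 2) • ∑ v ∈ box (d + 1) Lc, legInd (toSite r) ((Lc : ℤ) • p + toSite v))
    hLc (hG l) hδ (sfStep Lc l) (smStep d Lc l) (cH l) cout (hS l) hδs (fun p => rfl)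
    (fun p z b => abs_blockLegInd_le (toSite r) p z b) (fun p z b hh => blockLegInd_support hr p z b hh)
  -- the level-`l` constant is `|cout|·(q_l·M + q_l·M)`, monotone in `q_l ≤ c₀`
  have hq := hcH l
  have eA : (Fintype.card (Fib d) : ℝ) * ((Fintype.card (Fib d) : ℝ) * (C * (2 * |(sfStep Lc l * smStep d Lc l)⁻¹ * (cH l)⁻¹| *
      ((1 : ℝ) / 2 * (box (d + 1) Lc).card) * (((d + 1 : ℕ) : ℝ) * (C * Cs * Zl (d + 1) (min δs δ / 2))) *
      Real.exp (min δs δ / 2 / 2 * (2 * (((d + 1 : ℕ) : ℝ) * Lc))))) * Zl (d + 1) (min δs δ / 2 / 2 - min δs δ / 2 / 4) * C) *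
      Zl (d + 1) (min δs δ / 2 / 4 - min δs δ / 2 / 8) = |(sfStep Lc l * smStep d Lc l)⁻¹ * (cH l)⁻¹| * M := by
    rw [hM_def]; ring
  rw [eA] at h
  have hle : |cout| * (|(sfStep Lc l * smStep d Lc l)⁻¹ * (cH l)⁻¹| * M + |(sfStep Lc l * smStep d Lc l)⁻¹ * (cH l)⁻¹| * M) ≤ |cout| * (c₀ * M + c₀ * M) :=
    mul_le_mul_of_nonneg_left (add_le_add (mul_le_mul_of_nonneg_right hq hM) (mul_le_mul_of_nonneg_right hq hM)) (abs_nonneg _)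
  exact ⟨locStencil₂_le_mono h.1 hle le_rfl, locStencil₂_le_mono h.2 hle le_rfl⟩

/-! ## §3 `d = 3`, `Lc ≥ 2`, pin `cE = Lc⁴`: the rows for all levels, modulo the scalar row only -/

/-- NOT IN PRINT; OUR PROOF ATTEMPT ([folklore] composition: §2 ∘ road P1's `KSlotAssembly.convCKWall_holds` ⨾ asym1's `HessKerCoDressedBmWall.exists_coDressedBm_unit_rows` (the dressed K
uniform row) ∘ the OWNER gan24-p1 g22's `SrecAtSlotRowsFinal.exists_hS_hSall_SrecAt_three` ⨾ MY `WrecAtSlotRows.exists_spureRecAt_rows_three_of_srecAt_rows` («S′Shape»)).  **THE S-STEP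
LETTER ROWS `hE₁ ∕ hE₂` AT `d = 3` FOR ALL LEVELS WITH ONE `(CE, δE)`, MODULO THE SCALAR ROW `hcH` ONLY** (`2 ≤ Lc`, pin `cE = Lc^{3+1}`, every `cVH cΛ cout`, every in-block root `r`,
any residual letters `R l`, `R″ l`, any lock constants `cH l` with `|(sf_l·sm_l)⁻¹·(cH l)⁻¹| ≤ c₀`).  The located row (ii) of leaf-01 g72 (W-1 l.50491) for the whole tower: the
S-slot input of the (α-END-b) `hcell` chain is discharged down to road P1's K-slot and the OWNER's S-slot END.  Discharges NOTHING of `hcell` ∕ (Q-L) ∕ (C) ∕ «T2Shape^{ev}»;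
NEVER «G-an2-4 closed» as (CONV-C). -/
theorem exists_evenRows_uniform_three (hLc : 2 ≤ Lc) {cE : ℝ} (hcE : cE = (Lc : ℝ) ^ (3 + 1)) {r : Fin (3 + 1) → ℕ} (hr : r ∈ box (3 + 1) Lc)
    (cVH cΛ cout : ℝ) (cH : ℕ → ℝ) {c₀ : ℝ} (hcH : ∀ l, |(sfStep Lc l * smStep 3 Lc l)⁻¹ * (cH l)⁻¹| ≤ c₀)
    (R R'' : ℕ → (Fin (3 + 1) → ℤ) → Fin (3 + 1) → (Fin (3 + 1) → ℤ) → MKer (3 + 1) (Fib 3)) :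
    ∃ CE δE : ℝ, 0 < δE ∧ ∀ l,
      LocStencil₂ (fun (_ : Fin (3 + 1)) (p : Fin (3 + 1) → ℤ) (κ' : Fin (3 + 1)) (u' : Fin (3 + 1) → ℤ) =>
          cout • (e3OfK Lc (unitK (sfStep Lc l) (smStep 3 Lc l) (coDressKBmAt (toSite r) Lc (KInvStep (d := 3) Lc l)))
              (fun κ' u' => (sfStep Lc l * smStep 3 Lc l)⁻¹ • unitS (sfStep Lc l) (smStep 3 Lc l)
                (fun κ' u' => (cH l)⁻¹ • ((((1 : ℝ) + 1) / 2) • (comp (SpureRecAt 3 Lc (toSite r) cE cVH cΛ l κ' u')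
                    (diagK (((1 : ℝ) / 2) • ∑ v ∈ box (3 + 1) Lc, legInd (toSite r) ((Lc : ℤ) • p + toSite v)))
                  - comp (diagK (((1 : ℝ) / 2) • ∑ v ∈ box (3 + 1) Lc, legInd (toSite r) ((Lc : ℤ) • p + toSite v)))
                    (SpureRecAt 3 Lc (toSite r) cE cVH cΛ l κ' u')) + (((1 : ℝ) - 1) / 2) • R l p κ' u')) κ' u') κ' u'
            + e3OfK Lc (unitK (sfStep Lc l) (smStep 3 Lc l) (coDressKBmAt (toSite r) Lc (KInvStep (d := 3) Lc l)))
              (fun κ u => (sfStep Lc l * smStep 3 Lc l)⁻¹ • unitS (sfStep Lc l) (smStep 3 Lc l)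
                (fun κ u => (cH l)⁻¹ • ((((1 : ℝ) + 1) / 2) • (comp (SpureRecAt 3 Lc (toSite r) cE cVH cΛ l κ u)
                    (diagK (((1 : ℝ) / 2) • ∑ v ∈ box (3 + 1) Lc, legInd (toSite r) ((Lc : ℤ) • p + toSite v)))
                  - comp (diagK (((1 : ℝ) / 2) • ∑ v ∈ box (3 + 1) Lc, legInd (toSite r) ((Lc : ℤ) • p + toSite v)))
                    (SpureRecAt 3 Lc (toSite r) cE cVH cΛ l κ u)) + (((1 : ℝ) - 1) / 2) • R'' l p κ u)) κ u) κ' u')) CE δE ∧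
      LocStencil₂ (fun (κ : Fin (3 + 1)) (u : Fin (3 + 1) → ℤ) (_ : Fin (3 + 1)) (p : Fin (3 + 1) → ℤ) =>
          cout • (e3OfK Lc (unitK (sfStep Lc l) (smStep 3 Lc l) (coDressKBmAt (toSite r) Lc (KInvStep (d := 3) Lc l)))
              (fun κ' u' => (sfStep Lc l * smStep 3 Lc l)⁻¹ • unitS (sfStep Lc l) (smStep 3 Lc l)
                (fun κ' u' => (cH l)⁻¹ • ((((1 : ℝ) + 1) / 2) • (comp (SpureRecAt 3 Lc (toSite r) cE cVH cΛ l κ' u')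
                    (diagK (((1 : ℝ) / 2) • ∑ v ∈ box (3 + 1) Lc, legInd (toSite r) ((Lc : ℤ) • p + toSite v)))
                  - comp (diagK (((1 : ℝ) / 2) • ∑ v ∈ box (3 + 1) Lc, legInd (toSite r) ((Lc : ℤ) • p + toSite v)))
                    (SpureRecAt 3 Lc (toSite r) cE cVH cΛ l κ' u')) + (((1 : ℝ) - 1) / 2) • R l p κ' u')) κ' u') κ u
            + e3OfK Lc (unitK (sfStep Lc l) (smStep 3 Lc l) (coDressKBmAt (toSite r) Lc (KInvStep (d := 3) Lc l)))
              (fun κ u => (sfStep Lc l * smStep 3 Lc l)⁻¹ • unitS (sfStep Lc l) (smStep 3 Lc l)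
                (fun κ u => (cH l)⁻¹ • ((((1 : ℝ) + 1) / 2) • (comp (SpureRecAt 3 Lc (toSite r) cE cVH cΛ l κ u)
                    (diagK (((1 : ℝ) / 2) • ∑ v ∈ box (3 + 1) Lc, legInd (toSite r) ((Lc : ℤ) • p + toSite v)))
                  - comp (diagK (((1 : ℝ) / 2) • ∑ v ∈ box (3 + 1) Lc, legInd (toSite r) ((Lc : ℤ) • p + toSite v)))
                    (SpureRecAt 3 Lc (toSite r) cE cVH cΛ l κ u)) + (((1 : ℝ) - 1) / 2) • R'' l p κ u)) κ u) κ u)) CE δE := by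
  have hLc1 : 1 ≤ Lc := by omega
  obtain ⟨C, δK, cK, θK, hδK, -, -, hK, hKall⟩ := convCKWall_holds (Lc := Lc) hLc
  obtain ⟨c, -, hG, -⟩ := exists_coDressedBm_unit_rows hLc1 hr (sfStep Lc) (smStep 3 Lc) sfStep_ne_zero smStep_ne_zero
    (K := fun j => KInvStep (d := 3) Lc j) hδK hK hKall
  obtain ⟨Cs, cS, θS, δS, hθS0, hθS1, hδS, hall⟩ := exists_hS_hSall_SrecAt_three hLc hcE cVH cΛ
  obtain ⟨hS, hSall⟩ := hall r hr
  obtain ⟨Cs', cS', θ', δ', -, -, hδ', hS', -⟩ := exists_spureRecAt_rows_three_of_srecAt_rows hLc hr cE cVH cΛ hS hSall hδS hθS0 hθS1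
  exact exists_evenRows_uniform_of_rows hLc1 hr cE cVH cΛ cout cH hcH hG (by positivity) hS' hδ' R R''

end Summit.QuantumFields.BalabanUV.Beta.GAN24.BlockCommutatorStepLetter

end
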